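import Summits.NavierStokesRegularity.NavierStokesRegularity.Theses.ExtremalTypeIConstant
import Literature.Analysis.FluidPDE.ChaeWolfRemovingDSSBounds
import Literature.Analysis.FluidPDE.MildSolution
import Literature.Analysis.UnboundedOperators.HeatExtensionDecay
import HarnessLib

/-!
# Route ExtremalTypeIConstant · crux `SpiralScalingLiouville` (stmt-NavierStokesRegularity-8216) —
# the decided regime of SMALL Type-I constant (every rotation generator, the symmetry unused)

Support file (`--supports stmt-NavierStokesRegularity-8216`; theorems only, no definitions, no named
facts).  `SpiralScalingLiouville` asks that every element of the class `𝒜_C` — Oseen-mild ancient fields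
`u` on `ℝ³ × (−∞, 0)` with the Type-I TIME bound `‖u(t, x)‖ ≤ C/√(−t)` — which is invariant under a
one-parameter spiral-scaling group vanishes.  For SMALL `C` this holds for a trivial reason that uses
neither the symmetry nor any smoothness: the scale-invariant size `B = sup √(−t)‖u‖ ≤ C` obeys
`B ≤ B/2 + K₀B²` (mild identity from `4t` to `t`; the caloric term carries the factor
`√(−t)/√(−4t) = ½`, the Duhamel term is quadratic by Koch–Tataru's kernel bound
`‖K(τ, z)‖ ≤ C(τ + |z|²)^{−2}`), hence `B = 0` once `K₀B ≤ ¼`.  This is the substitute Step 1 of the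
tree's `ChaeWolf.exists_eps_typeI_small_eq_zero` with the mildness taken from the HYPOTHESES of `𝒜_C`
instead of from spatial Type-I decay (KNSS Thm 6.1), so that merely BOUNDED profiles are covered.

* `eq_zero_of_oseenMild_of_small_typeITime` — absolute `ε₀ > 0`: an Oseen-mild ancient field with
  `√(−t)‖u(t, x)‖ ≤ ε₀` throughout vanishes identically.
* `spiralScalingLiouville_of_small_typeI` — the RUNG: the binders of
  `ExtremalTypeIConstant.SpiralScalingLiouville` verbatim plus `C ≤ ε₀` give its conclusion `u ≡ 0`.

Companion (route CoriolisHead, crux `NoCoRotatingCore`): WITHOUT mildness the small-data conclusion is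
"the profile is constant" (`CoriolisHead.exists_eps_rotatedProfile_const_of_small_amplitude`, the
parasitic rotating constants being genuine bounded profiles); mildness is exactly what kills them.

HONEST FRAMING.  A decided regime (small data), not the crux: `SpiralScalingLiouville` for `C > ε₀`
(Pineau–Vicol's Conjecture 1.1 at `α ≈ 1`) stays OPEN, and Navier–Stokes regularity is NOT proved here.

References: D. Chae, J. Wolf, arXiv:1610.09464, §3 Step 1 [ChaeWolf2017RemovingDSS]; H. Koch,
D. Tataru, Adv. Math. 157 (2001), (14) [KochTataruAdvMath2001]; G. Koch, N. Nadirashvili, G. Seregin,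
V. Šverák, Acta Math. 203 (2009), §1 [KochNadirashviliSereginSverak2009]; B. Pineau, V. Vicol,
arXiv:2607.09619, Conj. 1.1 [PineauVicol2026].
-/

noncomputable section

-- the summit and its single sub-problem share the name (CONVENTIONS §1), as in every Theorems file
set_option linter.dupNamespace false

open MeasureTheory Set Function Filter Metric Real
open scoped ENNReal NNReal
open Literature.Analysis Literature.Analysis.FluidPDE
open Summit.NavierStokesRegularity.NavierStokesRegularity.Theses

namespace Summit.NavierStokesRegularity.NavierStokesRegularity.Theorems.SpiralScalingLiouville

/-- **Oseen-mild ancient fields with small scale-invariant size vanish.** There is an absolute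
`ε₀ > 0` such that every field `u : ℝ → ℝ³ → ℝ³` satisfying the Oseen (mild) identity
`u(t) = e^{(t−s)Δ}u(s) − ∫ₛᵗ∫ K(t − τ, x − y)[u(τ,y), u(τ,y)] dy dτ` for all `s < t < 0` and the bound
`√(−t)‖u(t, x)‖ ≤ ε₀` for all `t < 0`, `x`, vanishes identically on `t < 0`: with
`B = sup √(−t)‖u‖`, the identity from `4t` to `t` gives `B ≤ B/2 + K₀B²` (`K₀` absolute, from the
Koch–Tataru kernel bound), so `B = 0` once `K₀ B ≤ ¼`.  No smoothness, divergence or symmetry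
hypothesis is used. [cite: ChaeWolf2017RemovingDSS, §3 Step 1 (arXiv:1610.09464 p. 8); KochTataruAdvMath2001, (14)] -/
theorem eq_zero_of_oseenMild_of_small_typeITime :
    ∃ ε₀ : ℝ, 0 < ε₀ ∧ ∀ {u : ℝ → EuclideanSpace ℝ (Fin 3) → EuclideanSpace ℝ (Fin 3)},
      (∀ s t : ℝ, s < t → t < 0 → ∀ x, u t x = heatFlow (u s) (t - s) x -
        ∫ τ in Ioo s t, ∫ y, oseenKernel (t - τ) (x - y) (u τ y) (u τ y)) →
      (∀ t < 0, ∀ x, √(-t) * ‖u t x‖ ≤ ε₀) → ∀ t < 0, ∀ x, u t x = 0 := by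
  obtain ⟨C, hC, hK⟩ := exists_norm_oseenKernel_le (E := (EuclideanSpace ℝ (Fin 3)))
  set M₀ : ℝ := ∫ w : EuclideanSpace ℝ (Fin 3), (1 + ‖w‖ ^ 2) ^ (-(2 : ℝ)) with hM₀
  have hM₀0 : 0 ≤ M₀ := integral_nonneg fun w => Real.rpow_nonneg (by positivity) _
  set K₀ : ℝ := 4 * C * M₀ with hK₀
  have hK₀0 : 0 ≤ K₀ := by positivity
  set ε : ℝ := 1 / (4 * K₀ + 4) with hε
  have hε0 : 0 < ε := by positivity
  have hKε : K₀ * ε ≤ 1 / 4 := by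
    rw [hε, mul_one_div, div_le_iff₀ (by positivity)]
    linarith
  refine ⟨ε, hε0, ?_⟩
  intro u hmildAll hsmall
  -- the kernel bound in dimension three
  have finrank_R3_real : ((Module.finrank ℝ (EuclideanSpace ℝ (Fin 3)) : ℕ) : ℝ) = 3 := by
    simp
  have hK' : ∀ {τ : ℝ}, 0 < τ → ∀ z a b : (EuclideanSpace ℝ (Fin 3)),
      ‖oseenKernel τ z a b‖ ≤ C * (τ + ‖z‖ ^ 2) ^ (-(2 : ℝ)) * ‖a‖ * ‖b‖ := by
    intro τ hτ z a b
    have h := hK hτ z a b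
    rw [finrank_R3_real, show (-(((3 : ℝ) + 1) / 2)) = -(2 : ℝ) by norm_num] at h
    exact h
  -- the scale-invariant supremum `B`
  set S : Set ℝ := {r | ∃ t : ℝ, t < 0 ∧ ∃ x : EuclideanSpace ℝ (Fin 3), r = √(-t) * ‖u t x‖}
    with hS
  have hSb : BddAbove S := ⟨ε, by rintro r ⟨t, ht, x, rfl⟩; exact hsmall t ht x⟩
  have hSn : S.Nonempty := ⟨_, -1, by norm_num, 0, rfl⟩
  set B : ℝ := sSup S with hB
  have hqB : ∀ t < 0, ∀ x, √(-t) * ‖u t x‖ ≤ B := fun t ht x =>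
    le_csSup hSb ⟨t, ht, x, rfl⟩
  have hBε : B ≤ ε := csSup_le hSn (by rintro r ⟨t, ht, x, rfl⟩; exact hsmall t ht x)
  have hB0 : 0 ≤ B := le_trans (by positivity) (hqB (-1) (by norm_num) 0)
  have hptw : ∀ σ < 0, ∀ y, ‖u σ y‖ ≤ B / √(-σ) := by
    intro σ hσ y
    have hs : 0 < √(-σ) := Real.sqrt_pos.2 (by linarith)
    rw [le_div_iff₀ hs, mul_comm]
    exact hqB σ hσ y
  -- the key estimate `√(-t) ‖u(t, x)‖ ≤ B/2 + K₀ B²`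
  have hkey : ∀ t < 0, ∀ x, √(-t) * ‖u t x‖ ≤ B / 2 + K₀ * B ^ 2 := by
    intro t ht x
    set r : ℝ := √(-t) with hr
    have hr0 : 0 < r := Real.sqrt_pos.2 (by linarith)
    have hr2 : r ^ 2 = -t := Real.sq_sqrt (by linarith)
    -- the mild identity between `4t` and `t`
    have hmild := hmildAll (4 * t) t (by linarith) ht x
    have h3t : 0 < t - 4 * t := by linarith
    rw [heatFlow_of_pos _ h3t] at hmild
    -- the caloric term
    have hheat :
        ‖UnboundedOperators.heatExtension (u (4 * t)) (t - 4 * t) x‖ ≤ B / (2 * r) := by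
      have hb : ∀ z, ‖u (4 * t) z‖ ≤ B / (2 * r) := by
        intro z
        have := hptw (4 * t) (by linarith) z
        rwa [ChaeWolf.sqrt_neg_four_mul, ← hr] at this
      exact UnboundedOperators.norm_heatExtension_le_of_bound hb h3t x
    -- the Duhamel term
    have hduh : ‖∫ σ in Ioo (4 * t) t, ∫ y, oseenKernel (t - σ) (x - y) (u σ y) (u σ y)‖ ≤
        K₀ * B ^ 2 / r := by
      have hG : IntegrableOn (fun σ : ℝ => C * M₀ * (B ^ 2 / r ^ 2) * (t - σ) ^ (-(1 / 2 : ℝ)))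
          (Ioo (4 * t) t) := (ChaeWolf.integrableOn_rpow_sub ht).const_mul _
      have hpt : ∀ᵐ σ ∂(volume.restrict (Ioo (4 * t) t)),
          ‖∫ y, oseenKernel (t - σ) (x - y) (u σ y) (u σ y)‖ ≤
            C * M₀ * (B ^ 2 / r ^ 2) * (t - σ) ^ (-(1 / 2 : ℝ)) := by
        refine ae_restrict_of_forall_mem measurableSet_Ioo fun σ hσ => ?_
        have hσ0 : σ < 0 := hσ.2.trans ht
        have hτ : 0 < t - σ := by linarith [hσ.2]
        have h1 := ChaeWolf.norm_integral_oseenKernel_le hK' hC.le hτ x (hptw σ hσ0)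
        refine h1.trans ?_
        have hsq : (B / √(-σ)) ^ 2 = B ^ 2 / (-σ) := by
          rw [div_pow, Real.sq_sqrt (by linarith)]
        rw [hsq]
        have hw0 : 0 ≤ (t - σ) ^ (-(1 / 2 : ℝ)) := Real.rpow_nonneg (by linarith [hσ.2]) _
        have hfrac : B ^ 2 / (-σ) ≤ B ^ 2 / r ^ 2 := by
          rw [hr2]
          exact div_le_div_of_nonneg_left (sq_nonneg B) (by linarith) (by linarith [hσ.2])
        calc C * M₀ * (t - σ) ^ (-(1 / 2 : ℝ)) * (B ^ 2 / -σ)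
            ≤ C * M₀ * (t - σ) ^ (-(1 / 2 : ℝ)) * (B ^ 2 / r ^ 2) := by gcongr
          _ = C * M₀ * (B ^ 2 / r ^ 2) * (t - σ) ^ (-(1 / 2 : ℝ)) := by ring
      refine (norm_integral_le_of_norm_le hG hpt).trans ?_
      rw [MeasureTheory.integral_const_mul, ChaeWolf.integral_rpow_sub ht]
      have h3 := ChaeWolf.sqrt_neg_three_mul_le t ht
      rw [← hr] at h3
      have hrr : r ^ 2 = r * r := sq r
      calc C * M₀ * (B ^ 2 / r ^ 2) * (2 * √(-(3 * t)))
          ≤ C * M₀ * (B ^ 2 / r ^ 2) * (2 * (2 * r)) := by gcongr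
        _ = K₀ * B ^ 2 / r := by
            rw [hK₀, hrr]
            field_simp
            ring
    -- assemble
    have hnorm : ‖u t x‖ ≤ B / (2 * r) + K₀ * B ^ 2 / r := by
      rw [hmild]
      exact (norm_sub_le _ _).trans (add_le_add hheat hduh)
    calc r * ‖u t x‖ ≤ r * (B / (2 * r) + K₀ * B ^ 2 / r) := by gcongr
      _ = B / 2 + K₀ * B ^ 2 := by field_simp
  -- bootstrap: `B ≤ B/2 + K₀ B²` and `B ≤ ε` force `B = 0`
  have hB1 : B ≤ B / 2 + K₀ * B ^ 2 :=
    csSup_le hSn (by rintro r ⟨t, ht, x, rfl⟩; exact hkey t ht x)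
  have hB2 : K₀ * B ^ 2 ≤ B / 4 := by
    calc K₀ * B ^ 2 = (K₀ * B) * B := by ring
      _ ≤ (K₀ * ε) * B := by gcongr
      _ ≤ (1 / 4) * B := by gcongr
      _ = B / 4 := by ring
  have hB00 : B ≤ 0 := by linarith
  intro t ht x
  have hst : 0 < √(-t) := Real.sqrt_pos.2 (by linarith)
  have h := hqB t ht x
  have h' : √(-t) * ‖u t x‖ ≤ 0 := h.trans hB00
  have hn : ‖u t x‖ ≤ 0 := by
    by_contra hcon
    push Not at hcon
    have : 0 < √(-t) * ‖u t x‖ := mul_pos hst hcon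
    linarith
  exact norm_le_zero_iff.1 hn

/-- **RUNG of `SpiralScalingLiouville` (stmt-NavierStokesRegularity-8216): the small-constant regime.**
There is an absolute `ε₀ > 0` such that the binders of `ExtremalTypeIConstant.SpiralScalingLiouville`
verbatim — an Oseen-mild, divergence-free, jointly smooth ancient field on `ℝ³ × (−∞, 0)` in the
Type-I time class `𝒜_C` (`‖u(t, x)‖ ≤ C/√(−t)`), invariant under a spiral-scaling group — together
with `C ≤ ε₀` give its conclusion `u ≡ 0` (by `eq_zero_of_oseenMild_of_small_typeITime`; the
symmetry, smoothness and incompressibility are not used).  The crux for `C > ε₀` (the rotated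
self-similar Liouville problem at `α ≈ 1`) remains open.
[cite: ChaeWolf2017RemovingDSS, §3 Step 1 (arXiv:1610.09464 p. 8); PineauVicol2026, Conjecture 1.1 (arXiv:2607.09619 p. 3)] -/
theorem spiralScalingLiouville_of_small_typeI :
    ∃ ε₀ : ℝ, 0 < ε₀ ∧ ∀ (C : ℝ) (u : ℝ → EuclideanSpace ℝ (Fin 3) → EuclideanSpace ℝ (Fin 3)),
      ContDiffOn ℝ (⊤ : ℕ∞) (Function.uncurry u) (Set.Iio 0 ×ˢ Set.univ) ∧
        (∀ t < 0, Literature.Analysis.FluidPDE.VectorCalculus.IsDivFree (u t)) ∧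
        (∀ s t : ℝ, s < t → t < 0 → ∀ x, u t x =
          Literature.Analysis.FluidPDE.heatFlow (u s) (t - s) x -
            ∫ τ in Set.Ioo s t, ∫ y, Literature.Analysis.FluidPDE.oseenKernel (t - τ) (x - y) (u τ y) (u τ y)) ∧
        Literature.Analysis.FluidPDE.HasTypeITimeDecay C u →
      (∃ (a : EuclideanSpace ℝ (Fin 3)) (A : EuclideanSpace ℝ (Fin 3) →L[ℝ] EuclideanSpace ℝ (Fin 3)),
        (∀ x, inner ℝ (A x) x = 0) ∧ ∀ t < 0, ∀ x,
          fderiv ℝ (u t) x (a + x + A x) + u t x + (2 * t) • Literature.Analysis.FluidPDE.timeDeriv u t x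
            - A (u t x) = 0) →
      C ≤ ε₀ → ∀ t < 0, ∀ x, u t x = 0 := by
  obtain ⟨ε₀, hε₀, h⟩ := eq_zero_of_oseenMild_of_small_typeITime
  refine ⟨ε₀, hε₀, ?_⟩
  rintro C u ⟨-, -, hmild, hTI⟩ - hC t ht x
  refine h hmild (fun s hs y => ?_) t ht x
  have hss : 0 < √(-s) := Real.sqrt_pos.2 (by linarith)
  have h1 : ‖u s y‖ ≤ C / √(-s) := hTI s hs y
  rw [le_div_iff₀ hss] at h1
  linarith [h1]

/-- **RUNG of the TARGET `TypeIAncientLiouville` (stmt-NavierStokesRegularity-4050): the small-constant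
regime of the class `𝒜_C`.**  There is an absolute `ε₀ > 0` such that the binders of
`ExtremalTypeIConstant.TypeIAncientLiouville` verbatim — an Oseen-mild, divergence-free, jointly smooth
ancient field on `ℝ³ × (−∞, 0)` with `‖u(t, x)‖ ≤ C/√(−t)` — together with `C ≤ ε₀` give its conclusion
`u ≡ 0` (`eq_zero_of_oseenMild_of_small_typeITime`: small-data uniqueness of mild solutions; the
conjecture for large `C` — Koch–Nadirashvili–Seregin–Šverák's Liouville problem — is untouched).
[cite: KochNadirashviliSereginSverak2009, §1 (the Liouville conjecture for mild bounded ancient solutions); ChaeWolf2017RemovingDSS, §3 Step 1 (arXiv:1610.09464 p. 8)] -/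
theorem typeIAncientLiouville_of_small_typeI :
    ∃ ε₀ : ℝ, 0 < ε₀ ∧ ∀ (C : ℝ) (u : ℝ → EuclideanSpace ℝ (Fin 3) → EuclideanSpace ℝ (Fin 3)),
      ContDiffOn ℝ (⊤ : ℕ∞) (Function.uncurry u) (Set.Iio 0 ×ˢ Set.univ) ∧
        (∀ t < 0, Literature.Analysis.FluidPDE.VectorCalculus.IsDivFree (u t)) ∧
        (∀ s t : ℝ, s < t → t < 0 → ∀ x, u t x =
          Literature.Analysis.FluidPDE.heatFlow (u s) (t - s) x -
            ∫ τ in Set.Ioo s t, ∫ y, Literature.Analysis.FluidPDE.oseenKernel (t - τ) (x - y) (u τ y) (u τ y)) ∧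
        Literature.Analysis.FluidPDE.HasTypeITimeDecay C u →
      C ≤ ε₀ → ∀ t < 0, ∀ x, u t x = 0 := by
  obtain ⟨ε₀, hε₀, h⟩ := eq_zero_of_oseenMild_of_small_typeITime
  refine ⟨ε₀, hε₀, ?_⟩
  rintro C u ⟨-, -, hmild, hTI⟩ hC t ht x
  refine h hmild (fun s hs y => ?_) t ht x
  have hss : 0 < √(-s) := Real.sqrt_pos.2 (by linarith)
  have h1 : ‖u s y‖ ≤ C / √(-s) := hTI s hs y
  rw [le_div_iff₀ hss] at h1
  linarith [h1]

end Summit.NavierStokesRegularity.NavierStokesRegularity.Theorems.SpiralScalingLiouville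

end
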